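/-
  Summits/AtomisticToContinuum/Crystallization/Theorems/OverbindingBudgetAffineFarDevelopment.lean

  residual stmt-AtomisticToContinuum-31280 · slot Z `FarAggregatePricing 12 (1/25) (1/2000) (1/(2·10⁷))` · the L-slot's rank-2 UNDECIDED potential-free
  leaf DC `ShelteredQuarticCount` (…FarQuarticCount, leaf list v11, critic row 843): THE DEVELOPMENT OF SHELTERED GOOD MATTER and the two classical
  halves of the discrete Liouville dictionary — INJECTIVE DEVELOPMENT (DEV) and HÖLDER GROWTH OF THE DEVELOPED RADIUS (QS)
  (decomp-a2c lens-4 «minimal counterexample / extremal reduction», g53).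
  Imports ONLY `…OverbindingBudgetAffineFarQuarticCount` (lens-4 g52, landing GO row 843).  0 sorry · 0 axiom · no instance · no notation · no option.
-/
import Summits.AtomisticToContinuum.Crystallization.Theorems.OverbindingBudgetAffineFarQuarticCount

/-! # DC ⟸ DEV ∧ QS — the quartic count from an injective development with Hölder growth; DEV ⟸ HOL ∧ INJ

THESIS (g53).  Every counterexample to DC reduces to a DEVELOPED one, and a developed one cannot densify.  The extremal quantity is the
DEVELOPED RADIUS `ρ_i(r) := max {dist (Φ k) (Φ i) : dist (y k) (y i) ≤ r·nn_i}` of a development `Φ` of the yolk (lattice side, unit spacing):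
the sites of the physical `r·nn_i`-ball develop injectively onto a `1`-separated set inside the lattice ball of radius `ρ_i(r)`, so the count is
`≤ (2ρ_i(r) + 1)³` (`card_le_of_separated_of_dist_le`, volume packing) and DC's `H·r⁴` is exactly `ρ_i(r)³ ≤ C·r⁴`, i.e. `ρ_i(r) ≲ r^{4/3}`.
(1) DC ⟸ DEV ∧ QS (`shelteredQuarticCount_of_development_growth`, PROVED: `H := 27C`, `λ := 2λ_Q`, `ε := min ε_D ε_Q`).
(2) DEV ⟸ HOL ∧ INJ (`shelteredDevelopment_of_holonomy_injectivity`, PROVED: `λ_D := λ_I(λ_H)`), the optional second layer isolating the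
    injectivity radius.  Records: FF, Z3k and slot Z from EIGHT leaves with DC ↦ DEV ∧ QS (`farAggregatePricing_record_of_leaves_developed`).

THE OBJECT (new in the lineage; chart-free, potential-free).  A map `Φ : Fin N → E³` is FRAMED at tolerance `(θ_F, η_F)` on the open ball
`B(c, R)` (`IsFramedOn θ_F η_F R y c Φ`) if every site `j` there carries a linear FRAME `B_j`, `θ_F`-close to a linear isometry
(`‖B_j v − O_j v‖ ≤ θ_F‖v‖`), with `‖(Φ k − Φ j) − B_j((y k − y j)/nn_j)‖ ≤ η_F` for every site `k` within `(3/2)·nn_j` of `y j` — `Φ` is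
differentiable at lattice scale with near-isometric derivative after the LOCAL rescaling by `nn_j` (a discrete conformal = quasiregular map
whose conformal factor is the local spacing); it is SEPARATED on `B(c, R)` (`IsSeparatedOn R y c Φ`) if distinct sites there develop `≥ 1`
apart.  Tolerances are instantiated `(2θ, 4ε₁)`: the exact Barlow development of an `AffFramed(ε₁, θ)` cluster with chart `(Q, A, P, f)` has
`Φ(f v) − Φ j = O_j v`, frame `B_j := O_j A⁻¹`; the six SECOND-shell vectors (`‖v‖ = √2`; `Σ v vᵀ = 4·Id` for `fccSecondShellInt` and
`hcpSecondShellInt` alike) give `‖A − Q‖ ≤ (√6/2)θ ≈ 1.23θ` (the twelve first-shell unit vectors alone: `√3θ`), whence `‖B_j − O_j Q⁻¹‖ ≤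
1.23θ/(1 − 1.23θ) = 0.0515 ≤ 2θ = 0.08` (margin 35 %) and position error `‖A⁻¹‖ε₁ ≤ 1.06ε₁ ≤ 4ε₁` at `θ = 1/25`.
PL-DILATATION (the first stub of QS and of INJ, constants explicit — row 843 (5)): on a Delaunay simplex `σ` of the star of a yolk site `j`
(near-regular tetrahedron or octahedral quarter; normalised edge matrix `‖U_σ⁻¹‖ ≤ 2.2`) the affine interpolant of a `(2θ, 4ε₁)`-framed `Φ` has
linear part `L_σ` with `‖L_σ − O_j‖ ≤ 2θ + 32ε₁ =: τ` (`(L_σ − B_j) u_a = e_a − e_0`, `‖e_a‖ ≤ 4ε₁`, `‖Σ c_a (e_a − e_0)‖ ≤ 8√3‖U_σ⁻¹‖ε₁‖x‖`), so the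
PL extension of a framed map is `K_PL`-quasiregular with `H_lin ≤ (1+τ)/(1−τ) = 1.21` and `K_PL ≤ H_lin² ≤ 1.47` at `(θ, ε₁) = (1/25, 1/2000)`;
the count exponent is `p = 3·K_PL^{1/2} ≤ 3·H_lin ≤ 3.63 < 4` (`C = 2`, `C′ = 32`).

THE PIECES (all four typed over existing declarations; `R_aff` kept as the lineage's standing premise so each is ≤ DC in shape)
* DEV · `ShelteredDevelopment θ θ₀` [NEW LEAF · rank 2 · UNDECIDED · TRUE-type · ATTACKABLE-L HEAVY · IDEA-NEEDED(elementary injectivity)]: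
  R_aff ⇒ `∃ λ_D ≥ 2, ε_D > 0 ∀ ε₁ ≤ ε_D ∀ δ ∈ (0,2] ∀ y inj ∀ i ∈ Far ∖ sb ∀ m`: if every site within `m·nn_i` of `y i` is GOOD, some `Φ` is
  `(2θ, 4ε₁)`-framed AND separated on the yolk `B(y i, (m/λ_D)·nn_i)`.  WHY TRUE (paper): (HOL) the two-shell charts of a defect-free ball have
  transition motions determined by their ≥ 6-point non-coplanar overlaps, the holonomy around every bonded triangle is a pattern symmetry
  `O(ε₁)`-close to the identity, hence the identity, and the clique complex of close-packed matter in a ball is simply connected — the charts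
  DEVELOP into one map (layer propagation, Hales, Dense Sphere Packings §1.3); (INJ) its PL extension is a `K'`-quasiregular LOCAL HOMEOMORPHISM of
  the round clear ball, `K' = K_PL ≤ ((1+τ)/(1−τ))² ≤ 1.47` (`τ = 2θ + 32ε₁`), hence injective on a concentric sub-ball of universal ratio `ψ(3, K')` — the
  injectivity radius of Martio–Rickman–Väisälä (Rickman, Quasiregular Mappings, Thm III.3.4 [galaxy:panama:215676077735978 p.63–64]; an `n ≥ 3`
  phenomenon, Zorich), and injective exact developments are `1`-separated (Barlow sets).  WHY IT MIGHT FAIL: no mechanism known — the frame tolerance has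
  35 % margin on BOTH patterns (checked above), folding needs a non-good seam or `K' ≫ 1`; the residual risk is typing at the yolk rim (the `3/2`-shells
  of rim sites leave the yolk — covered by `λ_D ≥ 2` and shelter at `m`).  WHY STRICTLY WEAKER
  than DC / not DC again: no count, no radius growth — DEV holds verbatim for densifying developments of any exponent; conversely DC says nothing about
  developability.  INSTRUMENT: none needed beyond SM's (development exists in every toy by construction); the informative instrument is QS's.
* QS · `ShelteredHolderGrowth θ θ₀` [NEW LEAF · rank 2 · UNDECIDED · TRUE-type (margin ≈ 0.37 in the exponent: `p ≤ 3.63 < 4`) · INSTRUMENTABLE · ATTACKABLE-L HEAVY]: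
  R_aff ⇒ `∀ λ' ≥ 2 ∃ C ≥ 1, λ_Q ≥ λ', ε_Q > 0 ∀ ε₁ ≤ ε_Q ∀ δ ∀ y ∀ i ∈ Far ∖ sb ∀ m`, sheltered at `m` ⇒ for EVERY `Φ` framed and separated on
  `B(y i, (m/λ')·nn_i)` and every `1 ≤ r ≤ m/λ_Q`: `∃ ρ ≥ 1, ρ³ ≤ C·r⁴`, all sites within `r·nn_i` of `y i` develop into `closedBall (Φ i) ρ` —
  the developed radius grows at most like `r^{4/3}` (rpow-free).  WHY TRUE (paper): the PL extension of a framed separated map is a `K'`-quasiconformal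
  EMBEDDING of the half-yolk (separation + near-isometric simplices exclude overlaps elementarily), hence quasisymmetric on a concentric sub-ball
  (Gehring; Väisälä, Lectures on n-dimensional qc mappings) with `η(t) ≤ C t^{√K'}`, `√K' ≤ H_lin ≤ 1.21`: `ρ ≤ 1.1·η(r) ≤ C r^{1.21}`, `ρ³ ≤ C r^{3.63}
  ≤ C r⁴` (ring argument: `cap₃ Φ⁻¹(B(Φ i, ρ) ∖ B̄(Φ i, ρ₁)) ≤ K'·4π (log ρ/ρ₁)⁻²` against Gehring's Teichmüller-ring lower bound `4π(log λ₃ r)⁻²(1+o(1))`,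
  the image ring kept inside the developed yolk by weak quasisymmetry — this is where `λ_Q/λ' ≥ 2λ₃H^{2√K'}` is spent); equivalently the
  conformal `3`-capacity of the ring between the spheres of radii `nn_i` and `r·nn_i`, `4π (log r)⁻²`, is quasi-preserved.
  Extremal = the radial trumpet (g52 erratum): `ρ = r^{1/α}`, `1/α ≤ 1.09 ≪ 4/3`.  WHY IT MIGHT FAIL: a framed separated map of a sheltered yolk
  that is not quasisymmetric at ratio `λ_Q⁻¹` — excluded on paper for embeddings of balls; the typed risk is the frame tolerance `2θ` (p = 3H_lin(2θ + 32ε₁)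
  must stay < 4: 3.63; it would break at `θ_F ≥ 1/7`).  WHY STRICTLY WEAKER than DC: conditional on a development (vacuous where none is given), a statement about maps not counts;
  than FF/SFB: no potential, no tail, no annulus.  INSTRUMENT «DEVELOPED-RADIUS» (census): on the FUNNEL-COUNT toys (radial trumpet = the super-linear
  family, Möbius blob, twists) report `max_k dist(Φ k, Φ i)` over the physical `r`-ball against `r^{4/3}` for `1 ≤ r ≤ m/2` (`Φ` = the toy's own lattice
  labels): predicted exponent `1/α_min ≈ 1.03–1.09`; KILL = exponent ≥ 4/3 inside the half clear radius with all sites verified good.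
* HOL · `ShelteredHolonomy θ θ₀` [optional layer-2 leaf · UNDECIDED · TRUE-type · ATTACKABLE-M (elementary, combinatorial)]: as DEV without separation —
  a framed `Φ` exists on `B(y i, (m/λ_H)·nn_i)`.  The shared combinatorial core of DEV and of SM's (COMB).
* INJ · `ShelteredInjectivity θ θ₀` [optional layer-2 leaf · UNDECIDED · TRUE-type · ATTACKABLE-L HEAVY (MRV III.3.4) · IDEA-NEEDED]: `∀ λ' ≥ 2 ∃ λ_I ≥ λ'`:
  every `Φ` framed on `B(y i, (m/λ')·nn_i)` of a sheltered ball is separated on `B(y i, (m/λ_I)·nn_i)`.  Not splittable further over approximate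
  frames: bending without stretching is impossible in a BALL, so frames near-isometric at EVERY yolk site already force the injectivity radius.
DEGENERATE AUDIT: `m ≤ 0` ⇒ empty yolk, DEV/HOL by any `Φ`, QS/INJ vacuous in `r` (`λ_Q r ≤ m` fails) ✓; `r = 1` ⇒ `ρ ≥ 1.1` forces `C ≥ 1.4` (existential) ✓;
the cheap `Φ := nn_i⁻¹ • y` is framed only where all yolk scales lie in `nn_i(1 ± 2θ)` — false on trumpets — so HOL/DEV are not provable by it ✓;
constants `λ_D, ε_D | C, λ_Q, ε_Q` before `ε₁, δ` (scale-free), as DC's `H, λ, ε_D` ✓.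
WHY NOVEL (vs v5–v11 and every slot-Z piece Z3b…Z3k, FF, SC, IC, NF, SM, SFB, DC): the first piece of the lineage whose object is the DEVELOPMENT
itself — a lattice-valued map — rather than an energy, a rechart class or a count; the discrete→quasiconformal dictionary the critic asked for (row 843
(5)) is made explicit as two cruxes that are the discrete avatars of two theorems of 3-D quasiregular theory (MRV injectivity radius ↦ DEV/INJ,
Gehring–Väisälä quasisymmetry ↦ QS), glued by pure packing.  Answer to row 843 (5): we AGREE the development is unavoidable — any chart-free route to
DC must still produce the radius function `ρ_i(r)`, which IS the development's modulus of quasisymmetry; a contact-graph 3-capacity comparison without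
development pays the non-sharp discrete isoperimetric constant inside the exponent, and the whole budget is `4/3.63`.
HIDDEN-GAUGE AUDIT: `Φ` is quantified (∃ in DEV/HOL, ∀ in QS/INJ), never pinned; frames `B_j` existential per site; no chart object, no potential,
no kernel; QS/INJ are invariant under `Φ ↦ g ∘ Φ` for rigid motions `g` ✓ (dist and frames transform covariantly).
-/

namespace Summit.AtomisticToContinuum.Crystallization.Theorems.OverbindingBudgetAffineFarSmoothSplit

open scoped BigOperators Classical
open Literature.MathematicalPhysics.StatisticalMechanics
open Literature.Geometry.DiscreteGeometry (nearestDist nearestDist_nonneg)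
open Summit.AtomisticToContinuum.Crystallization.Theorems.OverbindingBudgetBalancedCensusStatements
open Summit.AtomisticToContinuum.Crystallization.Theorems.OverbindingBudgetAffineLadder
open Summit.AtomisticToContinuum.Crystallization.Theorems.OverbindingBudgetAffineLocalisation

variable {N : ℕ}

/-! ## §1  Framed and separated maps (the development, chart-free) -/

/-- `IsFramedOn θF ηF R y c Φ`: on the open ball `dist (y j) c < R` the map `Φ` is FRAMED — every site `j` there has a linear frame `B`, `θF`-close to a
linear isometry `O` (`‖B v − O v‖ ≤ θF·‖v‖`), with `‖(Φ k − Φ j) − B ((nn_j)⁻¹ • (y k − y j))‖ ≤ ηF` for every site `k` within `(3/2)·nn_j` of `y j`. -/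
def IsFramedOn (θF ηF R : ℝ) (y : Fin N → EuclideanSpace ℝ (Fin 3)) (c : EuclideanSpace ℝ (Fin 3))
    (Φ : Fin N → EuclideanSpace ℝ (Fin 3)) : Prop :=
  ∀ j : Fin N, dist (y j) c < R →
    ∃ (B : EuclideanSpace ℝ (Fin 3) →ₗ[ℝ] EuclideanSpace ℝ (Fin 3)) (O : EuclideanSpace ℝ (Fin 3) →ₗᵢ[ℝ] EuclideanSpace ℝ (Fin 3)),
      (∀ v, ‖B v - O v‖ ≤ θF * ‖v‖) ∧
        ∀ k : Fin N, dist (y k) (y j) ≤ 3 / 2 * nearestDist y j →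
          ‖(Φ k - Φ j) - B ((nearestDist y j)⁻¹ • (y k - y j))‖ ≤ ηF

/-- `IsSeparatedOn R y c Φ`: distinct sites of the open ball `dist (y k) c < R` develop at least `1` apart. -/
def IsSeparatedOn (R : ℝ) (y : Fin N → EuclideanSpace ℝ (Fin 3)) (c : EuclideanSpace ℝ (Fin 3))
    (Φ : Fin N → EuclideanSpace ℝ (Fin 3)) : Prop :=
  ∀ k k' : Fin N, dist (y k) c < R → dist (y k') c < R → k ≠ k' → 1 ≤ dist (Φ k) (Φ k')

/-- Framing is inherited by smaller balls. [this file] -/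
theorem IsFramedOn.mono {θF ηF R R' : ℝ} {y : Fin N → EuclideanSpace ℝ (Fin 3)} {c : EuclideanSpace ℝ (Fin 3)}
    {Φ : Fin N → EuclideanSpace ℝ (Fin 3)} (h : IsFramedOn θF ηF R y c Φ) (hR : R' ≤ R) : IsFramedOn θF ηF R' y c Φ :=
  fun j hj => h j (lt_of_lt_of_le hj hR)

/-- Separation is inherited by smaller balls. [this file] -/
theorem IsSeparatedOn.mono {R R' : ℝ} {y : Fin N → EuclideanSpace ℝ (Fin 3)} {c : EuclideanSpace ℝ (Fin 3)}
    {Φ : Fin N → EuclideanSpace ℝ (Fin 3)} (h : IsSeparatedOn R y c Φ) (hR : R' ≤ R) : IsSeparatedOn R' y c Φ :=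
  fun k k' hk hk' => h k k' (lt_of_lt_of_le hk hR) (lt_of_lt_of_le hk' hR)

/-- The yolk is monotone in `λ`: for `0 < λ ≤ λ'` and `nn > 0`, `dist < (m/λ')·nn ⇒ dist < (m/λ)·nn` (for `m < 0` the smaller yolk is empty). [this file] -/
theorem yolk_mono {m lam lam' nn d : ℝ} (hlam : 0 < lam) (hll : lam ≤ lam') (hnn : 0 < nn) (hd0 : 0 ≤ d)
    (hd : d < m / lam' * nn) : d < m / lam * nn := by
  have hlam' : 0 < lam' := lt_of_lt_of_le hlam hll
  rcases le_or_gt 0 m with hm | hm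
  · exact lt_of_lt_of_le hd (mul_le_mul_of_nonneg_right (div_le_div_of_nonneg_left hm hlam hll) hnn.le)
  · exact absurd (lt_of_le_of_lt hd0 hd) (not_lt.mpr (mul_nonpos_of_nonpos_of_nonneg (div_neg_of_neg_of_pos hm hlam').le hnn.le))

/-! ## §2  The pieces: DEV and QS (layer 1), HOL and INJ (layer 2) -/

/-- **DEV · `ShelteredDevelopment θ θ₀`** (NEW LEAF · rank 2 · UNDECIDED · TRUE-type (trivial holonomy + MRV injectivity radius, Rickman QRM III.3.4) ·
ATTACKABLE-L · IDEA-NEEDED): R_aff ⇒ `∃ λ_D ≥ 2, ε_D > 0 ∀ ε₁ ≤ ε_D ∀ δ ∈ (0,2]`, for every injective configuration, normal far row `i ∈ Far ∖ sb` and `m`: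
if every site within `m·nn_i` of `y i` (open ball) is GOOD, some `Φ` is `(2θ, 4ε₁)`-framed and separated on `B(y i, (m/λ_D)·nn_i)`.
Why it might fail: the frame tolerance `2θ`, not the geometry (folding needs a non-good seam or large dilatation). -/
def ShelteredDevelopment (θ θ₀ : ℝ) : Prop :=
  AffineChartStraightening → ∃ lamD εD : ℝ, 2 ≤ lamD ∧ 0 < εD ∧
    ∀ ε₁ : ℝ, 0 < ε₁ → ε₁ ≤ εD → ∀ δ : ℝ, 0 < δ → δ ≤ 2 →
      ∀ (N : ℕ) (y : Fin N → EuclideanSpace ℝ (Fin 3)), Function.Injective y →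
        ∀ i ∈ farSet θ₀ 12 ε₁ θ δ y \ goodScaleBadSet 12 ε₁ θ δ y, ∀ m : ℝ,
          (∀ k : Fin N, dist (y k) (y i) < m * nearestDist y i → k ∈ goodSet 12 ε₁ θ δ y) →
            ∃ Φ : Fin N → EuclideanSpace ℝ (Fin 3),
              IsFramedOn (2 * θ) (4 * ε₁) (m / lamD * nearestDist y i) y (y i) Φ ∧
                IsSeparatedOn (m / lamD * nearestDist y i) y (y i) Φ

/-- **QS · `ShelteredHolderGrowth θ θ₀`** (NEW LEAF · rank 2 · UNDECIDED · TRUE-type (quasisymmetry of qc embeddings of balls, exponent `√K' ≤ H_lin ≤ 1.21 < 4/3`) ·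
INSTRUMENTABLE («DEVELOPED-RADIUS») · ATTACKABLE-L HEAVY): R_aff ⇒ `∀ λ' ≥ 2 ∃ C ≥ 1, λ_Q ≥ λ', ε_Q > 0 ∀ ε₁ ≤ ε_Q ∀ δ ∈ (0,2]`, for every injective
configuration, normal far row `i ∈ Far ∖ sb` and `m`: if every site within `m·nn_i` is GOOD, then for every `Φ` framed and separated on `B(y i, (m/λ')·nn_i)`
and every `r` with `1 ≤ r`, `λ_Q·r ≤ m` there is `ρ ≥ 1` with `ρ³ ≤ C·r⁴` such that every site within `r·nn_i` of `y i` develops into `closedBall (Φ i) ρ`.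
Why it might fail: the frame tolerance `2θ` (`3·H_lin` must stay `< 4`); not quasisymmetry itself. -/
def ShelteredHolderGrowth (θ θ₀ : ℝ) : Prop :=
  AffineChartStraightening → ∀ lam' : ℝ, 2 ≤ lam' → ∃ C lamQ εQ : ℝ, 1 ≤ C ∧ lam' ≤ lamQ ∧ 0 < εQ ∧
    ∀ ε₁ : ℝ, 0 < ε₁ → ε₁ ≤ εQ → ∀ δ : ℝ, 0 < δ → δ ≤ 2 →
      ∀ (N : ℕ) (y : Fin N → EuclideanSpace ℝ (Fin 3)), Function.Injective y →
        ∀ i ∈ farSet θ₀ 12 ε₁ θ δ y \ goodScaleBadSet 12 ε₁ θ δ y, ∀ m : ℝ,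
          (∀ k : Fin N, dist (y k) (y i) < m * nearestDist y i → k ∈ goodSet 12 ε₁ θ δ y) →
            ∀ Φ : Fin N → EuclideanSpace ℝ (Fin 3),
              IsFramedOn (2 * θ) (4 * ε₁) (m / lam' * nearestDist y i) y (y i) Φ →
                IsSeparatedOn (m / lam' * nearestDist y i) y (y i) Φ →
                  ∀ r : ℝ, 1 ≤ r → lamQ * r ≤ m →
                    ∃ ρ : ℝ, 1 ≤ ρ ∧ ρ ^ 3 ≤ C * r ^ 4 ∧
                      ∀ k : Fin N, dist (y k) (y i) ≤ r * nearestDist y i → dist (Φ k) (Φ i) ≤ ρ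

/-- **HOL · `ShelteredHolonomy θ θ₀`** (optional layer-2 leaf · UNDECIDED · TRUE-type · ATTACKABLE-M): R_aff ⇒ `∃ λ_H ≥ 2, ε_H > 0 ∀ ε₁ ≤ ε_H ∀ δ ∀ y ∀ i ∀ m`,
sheltered at `m` ⇒ some `Φ` is `(2θ, 4ε₁)`-framed on `B(y i, (m/λ_H)·nn_i)` — the charts of a defect-free ball DEVELOP (trivial holonomy). -/
def ShelteredHolonomy (θ θ₀ : ℝ) : Prop :=
  AffineChartStraightening → ∃ lamH εH : ℝ, 2 ≤ lamH ∧ 0 < εH ∧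
    ∀ ε₁ : ℝ, 0 < ε₁ → ε₁ ≤ εH → ∀ δ : ℝ, 0 < δ → δ ≤ 2 →
      ∀ (N : ℕ) (y : Fin N → EuclideanSpace ℝ (Fin 3)), Function.Injective y →
        ∀ i ∈ farSet θ₀ 12 ε₁ θ δ y \ goodScaleBadSet 12 ε₁ θ δ y, ∀ m : ℝ,
          (∀ k : Fin N, dist (y k) (y i) < m * nearestDist y i → k ∈ goodSet 12 ε₁ θ δ y) →
            ∃ Φ : Fin N → EuclideanSpace ℝ (Fin 3), IsFramedOn (2 * θ) (4 * ε₁) (m / lamH * nearestDist y i) y (y i) Φ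

/-- **INJ · `ShelteredInjectivity θ θ₀`** (optional layer-2 leaf · UNDECIDED · TRUE-type (MRV injectivity radius `ψ(3, K')`, Rickman QRM III.3.4) ·
ATTACKABLE-L HEAVY · IDEA-NEEDED): R_aff ⇒ `∀ λ' ≥ 2 ∃ λ_I ≥ λ', ε_I > 0 ∀ ε₁ ≤ ε_I ∀ δ ∀ y ∀ i ∀ m`, sheltered at `m` ⇒ every `Φ` that is
`(2θ, 4ε₁)`-framed on `B(y i, (m/λ')·nn_i)` is separated on `B(y i, (m/λ_I)·nn_i)`. -/
def ShelteredInjectivity (θ θ₀ : ℝ) : Prop :=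
  AffineChartStraightening → ∀ lam' : ℝ, 2 ≤ lam' → ∃ lamI εI : ℝ, lam' ≤ lamI ∧ 0 < εI ∧
    ∀ ε₁ : ℝ, 0 < ε₁ → ε₁ ≤ εI → ∀ δ : ℝ, 0 < δ → δ ≤ 2 →
      ∀ (N : ℕ) (y : Fin N → EuclideanSpace ℝ (Fin 3)), Function.Injective y →
        ∀ i ∈ farSet θ₀ 12 ε₁ θ δ y \ goodScaleBadSet 12 ε₁ θ δ y, ∀ m : ℝ,
          (∀ k : Fin N, dist (y k) (y i) < m * nearestDist y i → k ∈ goodSet 12 ε₁ θ δ y) →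
            ∀ Φ : Fin N → EuclideanSpace ℝ (Fin 3),
              IsFramedOn (2 * θ) (4 * ε₁) (m / lam' * nearestDist y i) y (y i) Φ →
                IsSeparatedOn (m / lamI * nearestDist y i) y (y i) Φ

/-! ## §3  DC ⟸ DEV ∧ QS — packing the developed ball (PROVED) -/

/-- ★ **`ShelteredDevelopment ∧ ShelteredHolderGrowth ⇒ ShelteredQuarticCount`** — `H := 27C`, `λ := 2λ_Q(λ_D)`, `ε := min ε_D ε_Q`: the sites of the
physical `r·nn_i`-ball lie in the yolk (`r ≤ m/(2λ_Q) < m/λ_D`), develop injectively onto a `1`-separated subset of `closedBall (Φ i) ρ`, so they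
number `≤ (2ρ + 1)³ ≤ 27ρ³ ≤ 27C·r⁴` (`card_le_of_separated_of_dist_le`, `finrank = 3`). [this file] -/
theorem shelteredQuarticCount_of_development_growth {θ θ₀ : ℝ}
    (hD : ShelteredDevelopment θ θ₀) (hQ : ShelteredHolderGrowth θ θ₀) : ShelteredQuarticCount θ θ₀ := by
  intro hR
  obtain ⟨lamD, εD, hlamD, hεD, hDEV⟩ := hD hR
  obtain ⟨C, lamQ, εQ, hC, hlamQ, hεQ, hQS⟩ := hQ hR lamD hlamD
  refine ⟨27 * C, 2 * lamQ, min εD εQ, by linarith, by linarith, lt_min hεD hεQ, ?_⟩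
  intro ε₁ hε₁ hε₁m δ hδ hδ2 N y hy i hi m hshel r hr1 hrm
  obtain ⟨Φ, hΦF, hΦS⟩ := hDEV ε₁ hε₁ (hε₁m.trans (min_le_left _ _)) δ hδ hδ2 N y hy i hi m hshel
  have hlamQ0 : 0 < lamQ := by linarith
  have hr0 : 0 < r := by linarith
  have hrm' : lamQ * r ≤ m := by nlinarith
  obtain ⟨ρ, hρ1, hρC, hρ⟩ :=
    hQS ε₁ hε₁ (hε₁m.trans (min_le_right _ _)) δ hδ hδ2 N y hy i hi m hshel Φ hΦF hΦS r hr1 hrm'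
  have hiG : i ∈ goodSet 12 ε₁ θ δ y := farSet_subset_goodSet θ₀ 12 ε₁ θ δ y (Finset.mem_sdiff.mp hi).1
  have hnn : 0 < nearestDist y i := lt_of_lt_of_le hδ (inWindow_of_mem_goodSet hiG).1
  -- the counted ball lies inside the yolk
  have hryolk : r * nearestDist y i < m / lamD * nearestDist y i := by
    refine mul_lt_mul_of_pos_right ?_ hnn
    rw [lt_div_iff₀ (by linarith)]
    nlinarith
  set T : Finset (Fin N) := Finset.univ.filter fun k : Fin N => dist (y k) (y i) ≤ r * nearestDist y i with hT
  have hTy : ∀ k ∈ T, dist (y k) (y i) < m / lamD * nearestDist y i := fun k hk => by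
    rw [hT, Finset.mem_filter] at hk; exact lt_of_le_of_lt hk.2 hryolk
  have hinj : Set.InjOn Φ ↑T := fun k hk k' hk' hkk' => by
    by_contra hne
    have h1 := hΦS k k' (hTy k hk) (hTy k' hk') hne
    rw [hkk', dist_self] at h1
    linarith
  have hcard : ((T.image Φ).card : ℝ) ≤ (2 * ρ / 1 + 1) ^ Module.finrank ℝ (EuclideanSpace ℝ (Fin 3)) :=
    card_le_of_separated_of_dist_le (T.image Φ) (Φ i) one_pos (by linarith)
      (fun c hc => by
        obtain ⟨k, hk, rfl⟩ := Finset.mem_image.mp hc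
        rw [hT, Finset.mem_filter] at hk
        exact hρ k hk.2)
      (fun c hc d hd hcd => by
        obtain ⟨k, hk, rfl⟩ := Finset.mem_image.mp hc
        obtain ⟨k', hk', rfl⟩ := Finset.mem_image.mp hd
        exact hΦS k k' (hTy k hk) (hTy k' hk') fun h => hcd (by rw [h]))
  rw [finrank_euclideanSpace_fin, Finset.card_image_of_injOn hinj] at hcard
  have hρ0 : 0 ≤ ρ := by linarith
  calc (T.card : ℝ) ≤ (2 * ρ / 1 + 1) ^ 3 := hcard
    _ ≤ (3 * ρ) ^ 3 := pow_le_pow_left₀ (by positivity) (by linarith) 3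
    _ = 27 * ρ ^ 3 := by ring
    _ ≤ 27 * (C * r ^ 4) := mul_le_mul_of_nonneg_left hρC (by norm_num)
    _ = 27 * C * r ^ 4 := by ring

/-! ## §4  DEV ⟸ HOL ∧ INJ — the injectivity radius isolated (PROVED) -/

/-- ★ **`ShelteredHolonomy ∧ ShelteredInjectivity ⇒ ShelteredDevelopment`** — `λ_D := λ_I(λ_H) ≥ λ_H`, `ε_D := min ε_H ε_I`: the framed map of HOL on
the `λ_H`-yolk is framed on the smaller `λ_I`-yolk (`yolk_mono`) and separated there by INJ. [this file] -/
theorem shelteredDevelopment_of_holonomy_injectivity {θ θ₀ : ℝ}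
    (hH : ShelteredHolonomy θ θ₀) (hI : ShelteredInjectivity θ θ₀) : ShelteredDevelopment θ θ₀ := by
  intro hR
  obtain ⟨lamH, εH, hlamH, hεH, hHOL⟩ := hH hR
  obtain ⟨lamI, εI, hlamI, hεI, hINJ⟩ := hI hR lamH hlamH
  refine ⟨lamI, min εH εI, le_trans hlamH hlamI, lt_min hεH hεI, ?_⟩
  intro ε₁ hε₁ hε₁m δ hδ hδ2 N y hy i hi m hshel
  obtain ⟨Φ, hΦF⟩ := hHOL ε₁ hε₁ (hε₁m.trans (min_le_left _ _)) δ hδ hδ2 N y hy i hi m hshel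
  have hiG : i ∈ goodSet 12 ε₁ θ δ y := farSet_subset_goodSet θ₀ 12 ε₁ θ δ y (Finset.mem_sdiff.mp hi).1
  have hnn : 0 < nearestDist y i := lt_of_lt_of_le hδ (inWindow_of_mem_goodSet hiG).1
  refine ⟨Φ, fun j hj => hΦF j (yolk_mono (by linarith) hlamI hnn dist_nonneg hj),
    hINJ ε₁ hε₁ (hε₁m.trans (min_le_right _ _)) δ hδ hδ2 N y hy i hi m hshel Φ hΦF⟩

/-- **`ShelteredHolonomy ∧ ShelteredInjectivity ∧ ShelteredHolderGrowth ⇒ ShelteredQuarticCount`** (the three-leaf reading: composition of §4 and §3). [this file] -/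
theorem shelteredQuarticCount_of_holonomy_injectivity_growth {θ θ₀ : ℝ} (hH : ShelteredHolonomy θ θ₀) (hI : ShelteredInjectivity θ θ₀)
    (hQ : ShelteredHolderGrowth θ θ₀) : ShelteredQuarticCount θ θ₀ :=
  shelteredQuarticCount_of_development_growth (shelteredDevelopment_of_holonomy_injectivity hH hI) hQ

/-! ## §5  Records: FF and Z3k from DEV ∧ QS; slot Z from eight leaves with DC ↦ DEV ∧ QS -/

/-- **`ShelteredDevelopment ∧ ShelteredHolderGrowth ⇒ FarFieldShadowBound`** (via DC, SFB: §3 and …FarQuarticCount). [this file] -/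
theorem farFieldShadowBound_of_development_growth {θ θ₀ : ℝ} (hD : ShelteredDevelopment θ θ₀) (hQ : ShelteredHolderGrowth θ θ₀) :
    FarFieldShadowBound θ θ₀ :=
  farFieldShadowBound_of_quarticCount (shelteredQuarticCount_of_development_growth hD hQ)

/-- **`ShelteredDevelopment ∧ ShelteredHolderGrowth ∧ ShelteredMatching ⇒ SitewiseRechartLoss`** (Z3k by name). [this file] -/
theorem sitewiseRechartLoss_of_developed_sheltered {θ θ₀ : ℝ} (hD : ShelteredDevelopment θ θ₀) (hQ : ShelteredHolderGrowth θ θ₀)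
    (hS : ShelteredMatching θ θ₀) : SitewiseRechartLoss θ θ₀ :=
  sitewiseRechartLoss_of_quartic_sheltered (shelteredQuarticCount_of_development_growth hD hQ) hS

/-- ★ **SLOT Z FROM EIGHT LEAVES, the far field DEVELOPED:
`FarCoreExcess ∧ ShelteredFarCharting ∧ NormalCorePricing ∧ TailDriftBound ∧ ShelteredDevelopment ∧ ShelteredHolderGrowth ∧ ShelteredMatching ∧
ScaleBadFloor ⇒ FarAggregatePricing 12 (1/25) (1/2000) (1/(2·10⁷))`** — the record `farAggregatePricing_record_of_leaves_quartic` with DC from DEV ∧ QS. [this file] -/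
theorem farAggregatePricing_record_of_leaves_developed
    (h2 : FarCoreExcess (1 / 25) (1 / 2000) (1 / (2 * 10 ^ 7)))
    (hra : ShelteredFarCharting (1 / 25) (1 / 2000)) (hrb : NormalCorePricing (1 / 25))
    (h3a : TailDriftBound (1 / 25) (1 / 2000)) (hD : ShelteredDevelopment (1 / 25) (1 / 2000))
    (hQ : ShelteredHolderGrowth (1 / 25) (1 / 2000)) (hS : ShelteredMatching (1 / 25) (1 / 2000))
    (h4 : ScaleBadFloor (1 / 25) (1 / (2 * 10 ^ 7))) :
    FarAggregatePricing 12 (1 / 25) (1 / 2000) (1 / (2 * 10 ^ 7)) :=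
  farAggregatePricing_record_of_leaves_quartic h2 hra hrb h3a (shelteredQuarticCount_of_development_growth hD hQ) hS h4

end Summit.AtomisticToContinuum.Crystallization.Theorems.OverbindingBudgetAffineFarSmoothSplit
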